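import Literature.NumberTheory.Automorphic.HeckeTraceFormulaGL2LevelDimensionProofs
import Literature.NumberTheory.EllipticCurves.ModularCurveNewformDimension
import Literature.NumberTheory.EllipticCurves.NewformsOrthogonalBasisPrimeLevel
import Literature.NumberTheory.ModularForms.HalfIntegralWeightGammaZeroFourCuspFormsBound

/-!
# The Eichler–Selberg trace formula on `S₄(Γ₀(N))` at `n = 1`: the weight-4 dimension formula
# and the identity `dim S₄(Γ₀(M)) + dim S₂(Γ₀(M)) = dim S₂(Γ₀(3M))` (`3 ∤ M`)
# (proofs-only sibling of `HeckeTraceFormulaGL2Level.lean` / `…DimensionProofs.lean`; theorems only, D-0026)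

Topic `NumberTheory/Automorphic`. The named fact `HeckeTraceFormulaGL2Level N χ k` (R. Schoof,
M. van der Vlugt, JCTA **57** (1991), Thm. 2.2 p. 168) asserts `Tr(T_n | S_k(Γ₀(N), χ)) = A₁ + A₂ + A₃ + A₄`
for all `n ≥ 1`; its instance `n = 1` is the Cohen–Oesterlé dimension formula (loc. cit. Cor. 2.3).
`HeckeTraceFormulaGL2LevelDimensionProofs` PROVES that instance for `k = 2`.  This file EVALUATES the
geometric side of the instance `n = 1`, `k = 4`, `χ = 𝟙` at every level `N ≥ 1`:

* `A₁ = ψ(N)/4` (`identityTerm_one_four_one`);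
* `A₂ = +ν₂(N)/4` (`ellipticTerm_one_four_one`): the archimedean factor in weight `4` is
  `Q₂(t, 1) = t² − 1` (`archFactor_four_one`), which kills `t = ±1` and flips the sign at `t = 0`;
* `A₃ = −ν_∞(N)/2` (`hyperbolicTerm_one_four_one`, as in weight `2`);
* `A₄ = 0` (`parabolicTerm_of_ne_two`),

so `geometricSide N 1 4 1 = ψ(N)/4 + ν₂(N)/4 − ν_∞(N)/2` (`geometricSide_one_four_one`) — the classical
value of `dim S₄(Γ₀(N))` ([DiamondShurman2005] Thm. 3.5.1 at `k = 4`: `3(g − 1) + ε₂ + ε₃ + ε_∞`, with the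
genus formula).  Consequently, UNDER the `n = 1`, `k = 4` instance of the trace formula
(`cuspidalHeckeTrace N 4 1 1 = geometricSide N 1 4 1`, which `HeckeTraceFormulaGL2Level N 1 4` implies:
`traceFormula_four_one_one_of`), `dim S₄(Γ₀(N)) = ψ/4 + ν₂/4 − ν_∞/2` (`finrank_cuspForm_four_eq_of_trace`)
and, for `3 ∤ M`, `dim S₄(Γ₀(M)) + dim S₂(Γ₀(M)) = dim S₂(Γ₀(3M))`
(`finrank_cuspForm_four_add_two_eq_of_trace`; by the tree's THEOREMS `finrank_cuspForm_two_eq_genusX0_holds`,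
`twelve_mul_genusX0_holds` and the multiplicativity of `ψ, ν₂, ν₃, ν_∞`: both sides equal
`1 + ψ(M)/3 − ν₃(M)/3 − ν_∞(M)`).  The last identity is the dimension count behind the `p = 3` level-raising
/ Serre-weight bookkeeping `S₂(Γ₀(3M); 𝔽₃) "=" S₄(Γ₀(M); 𝔽₃) ⊕ V₃ S₂(Γ₀(M); 𝔽₃)` used on the BSD routes
(`Summits/BirchSwinnertonDyer/…/Theses/TameQuarticManinParity.lean`, items `MiddleResidueRankBound`,
`TwistedOldformResidueBasis`).  Nothing in this file asserts the trace formula; it is a hypothesis throughout.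

## References

* [SchoofVandervlugt1991] R. Schoof, M. van der Vlugt, JCTA 57 (1991) 163–186: Thm. 2.2 and Cor. 2.3, p. 168.
* [DiamondShurman2005] F. Diamond, J. Shurman, *A First Course in Modular Forms*, GTM 228: Thm. 3.1.1, Thm. 3.5.1,
  Fig. 3.3, §5.3 (`T_1 = 1`).
-/

noncomputable section

open scoped MatrixGroups ModularForm
open CongruenceSubgroup

namespace Literature.NumberTheory.Automorphic.HeckeTraceFormulaGL2Level

open Literature.NumberTheory.EllipticCurves.ModularForms

variable (N : ℕ) [NeZero N]

omit [NeZero N] in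
/-- Identity term at `n = 1`, `k = 4`, `χ = 𝟙`: `A₁ = ψ(N)/4`. [cite: SchoofVandervlugt1991, Thm. 2.2, p. 168] -/
theorem identityTerm_one_four_one : identityTerm N 1 4 1 = (dedekindPsi N : ℂ) / 4 := by
  unfold identityTerm
  rw [if_pos ⟨1, rfl⟩, Nat.sqrt_one, Nat.cast_one, one_zpow, Nat.cast_one, map_one]
  norm_num
  ring

/-- Hyperbolic term at `n = 1`, `k = 4`, `χ = 𝟙`: `A₃ = −ν_∞(N)/2` (as in weight `2`: only `d = 1`).
[cite: SchoofVandervlugt1991, Thm. 2.2, p. 168] -/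
theorem hyperbolicTerm_one_four_one : hyperbolicTerm N 1 4 1 = -((nuInfty N : ℂ) / 2) := by
  classical
  unfold hyperbolicTerm
  have hd : (Nat.divisors 1).filter (fun d ↦ d * d ≤ 1) = {1} := by decide
  rw [hd, Finset.sum_singleton, if_pos rfl, Nat.cast_one, one_zpow, mul_one, Nat.div_one]
  have hcond : (1 : DirichletCharacter ℂ N).conductor = 1 := DirichletCharacter.conductor_one
  rw [hcond, Nat.div_one]
  rw [Finset.filter_true_of_mem fun c hc ↦ ?_]
  · congr 1
    rw [nuInfty, Nat.cast_sum, Finset.sum_div, Finset.mul_sum]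
    refine Finset.sum_congr rfl fun c hc ↦ ?_
    have hcN : c ∣ N := Nat.dvd_of_mem_divisors hc
    rw [crtCharValue_one_one_one N (Nat.mul_div_cancel' hcN)]
    ring
  · refine ⟨(Nat.gcd_dvd_left _ _).trans (Nat.dvd_of_mem_divisors hc), ?_⟩
    simp

omit [NeZero N] in
/-- The archimedean factor in weight `4`: `Q₂(t, 1) = t² − 1` (`tracePoly 2`). [cite: SchoofVandervlugt1991, Thm. 2.2, p. 168] -/
theorem archFactor_four_one {t : ℤ} (ht : t ^ 2 < 4 * ((1 : ℕ) : ℤ)) :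
    archFactor 4 t 1 = (t : ℂ) ^ 2 - 1 := by
  have h := archFactor_eq_tracePoly ht 2
  have e : archFactor 4 t 1 = archFactor ((2 : ℕ) + 2) t 1 := by norm_num
  rw [e, h]
  simp [tracePoly]
  ring

/-- Elliptic term at `n = 1`, `k = 4`, `χ = 𝟙`: `A₂ = ν₂(N)/4` (`Q₂(0,1) = −1` with `h_w(−4) = 1/2`;
`Q₂(±1,1) = 0`). [cite: SchoofVandervlugt1991, Thm. 2.2, p. 168] -/
theorem ellipticTerm_one_four_one : ellipticTerm N 1 4 1 = (nu₂ N : ℂ) / 4 := by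
  classical
  unfold ellipticTerm
  rw [ellipticRange_one]
  have hc0 : ellipticConductors 0 1 = {1} := by decide
  have hc1 : ellipticConductors 1 1 = {1} := by decide
  have hcm1 : ellipticConductors (-1) 1 = {1} := by decide
  rw [Finset.sum_insert (by decide), Finset.sum_insert (by decide), Finset.sum_singleton, hc0, hc1, hcm1,
    Finset.sum_singleton, Finset.sum_singleton, Finset.sum_singleton,
    archFactor_four_one (by norm_num), archFactor_four_one (by norm_num), archFactor_four_one (by norm_num),
    localDensity_one_one_one, localDensity_one_one_one, localDensity_one_one_one]
  have h4 : ((0 : ℤ) ^ 2 - 4 * (1 : ℕ)) / ((1 : ℕ) : ℤ) ^ 2 = -4 := by norm_num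
  have h3 : ((1 : ℤ) ^ 2 - 4 * (1 : ℕ)) / ((1 : ℕ) : ℤ) ^ 2 = -3 := by norm_num
  have h3' : ((-1 : ℤ) ^ 2 - 4 * (1 : ℕ)) / ((1 : ℕ) : ℤ) ^ 2 = -3 := by norm_num
  rw [h4, h3, h3', weightedClassNumber_neg_four, weightedClassNumber_neg_three]
  have e0 : Nat.card {x : ZMod N // x ^ 2 - ((0 : ℤ) : ZMod N) * x + 1 = 0} = nu₂ N := by
    unfold nu₂
    exact Nat.card_congr (Equiv.subtypeEquivRight fun x ↦ by push_cast; ring_nf)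
  rw [e0]
  push_cast
  ring

/-- Geometric side at `n = 1`, `k = 4`, `χ = 𝟙`: `ψ(N)/4 + ν₂(N)/4 − ν_∞(N)/2`.
[cite: SchoofVandervlugt1991, Thm. 2.2 and Cor. 2.3, p. 168] [cite: DiamondShurman2005, Thm. 3.5.1] -/
theorem geometricSide_one_four_one :
    geometricSide N 1 4 1 = (gamma0Index N : ℂ) / 4 + (nu₂ N : ℂ) / 4 - (nuInfty N : ℂ) / 2 := by
  rw [geometricSide, identityTerm_one_four_one, ellipticTerm_one_four_one, hyperbolicTerm_one_four_one,
    parabolicTerm_of_ne_two _ _ (by norm_num), dedekindPsi_eq_gamma0Index_cast, Rat.cast_natCast]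
  ring

/-- The named fact `HeckeTraceFormulaGL2Level N 1 4` (all `n ≥ 1`) implies its instance `n = 1`.
[cite: SchoofVandervlugt1991, Thm. 2.2, p. 168] -/
theorem traceFormula_four_one_one_of (h : HeckeTraceFormulaGL2Level N 1 4) :
    cuspidalHeckeTrace N 4 1 1 = geometricSide N 1 4 1 := by
  have hχ : (1 : DirichletCharacter ℂ N) (-1) = (-1 : ℂ) ^ (4 : ℤ) := by
    rw [MulChar.one_apply isUnit_one.neg]
    norm_num
  exact h (by norm_num) hχ 1 one_pos

/-- `dim S₄(Γ₀(N)) = ψ(N)/4 + ν₂(N)/4 − ν_∞(N)/2`, GIVEN the trace formula at `n = 1`, `k = 4`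
(`T₁ = 1`: `cuspidalHeckeTrace_one_one`). [cite: SchoofVandervlugt1991, Thm. 2.2 and Cor. 2.3, p. 168] [cite: DiamondShurman2005, Thm. 3.5.1] -/
theorem finrank_cuspForm_four_eq_of_trace (h1 : cuspidalHeckeTrace N 4 1 1 = geometricSide N 1 4 1) :
    (Module.finrank ℂ (CuspForm (Gamma0 N) 4) : ℂ) =
      (gamma0Index N : ℂ) / 4 + (nu₂ N : ℂ) / 4 - (nuInfty N : ℂ) / 2 := by
  rw [cuspidalHeckeTrace_one_one, geometricSide_one_four_one] at h1
  exact h1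

omit [NeZero N] in
/-- `dim S₄(Γ₀(M)) + dim S₂(Γ₀(M)) = dim S₂(Γ₀(3M))` for `3 ∤ M`, GIVEN the trace formula at `n = 1`,
`k = 4`, level `M`; the weight-2 dimensions are the tree's theorems (`finrank_cuspForm_two_eq_genusX0_holds`,
`twelve_mul_genusX0_holds`, `gamma0Index_mul`, `nu₂_mul_of_coprime`, `nu₃_mul_of_coprime`,
`nuInfty_mul_of_coprime`): both sides equal `1 + ψ(M)/3 − ν₃(M)/3 − ν_∞(M)`.
[cite: DiamondShurman2005, Thm. 3.5.1, Fig. 3.3] -/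
theorem finrank_cuspForm_four_add_two_eq_of_trace (M : ℕ) [NeZero M] (h3M : ¬ 3 ∣ M)
    (h1 : cuspidalHeckeTrace M 4 1 1 = geometricSide M 1 4 1) :
    Module.finrank ℂ (CuspForm (Gamma0 M) 4) + Module.finrank ℂ (CuspForm (Gamma0 M) 2) =
      Module.finrank ℂ (CuspForm (Gamma0 (3 * M)) 2) := by
  classical
  have hM0 : M ≠ 0 := NeZero.ne M
  haveI : NeZero (3 * M) := ⟨by omega⟩
  have hcop : (3 : ℕ).Coprime M := (Nat.Prime.coprime_iff_not_dvd Nat.prime_three).2 h3M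
  have hγ : gamma0Index (3 * M) = 4 * gamma0Index M := by
    rw [gamma0Index_mul hcop, gamma0Index_prime Nat.prime_three]
  have hν2 : nu₂ (3 * M) = 0 := by
    haveI : Fact (Nat.Prime 3) := ⟨Nat.prime_three⟩
    rw [nu₂_mul_of_coprime hcop, nu₂_prime (p := 3) (by norm_num)]
    norm_num
  have hν3 : nu₃ (3 * M) = nu₃ M := by rw [nu₃_mul_of_coprime hcop, nu₃_three, one_mul]
  have hνi : nuInfty (3 * M) = 2 * nuInfty M := by
    rw [nuInfty_mul_of_coprime hcop, nuInfty_prime Nat.prime_three]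
  have hg3 := finrank_cuspForm_two_eq_genusX0_holds (3 * M)
  have hgM := finrank_cuspForm_two_eq_genusX0_holds M
  unfold finrank_cuspForm_two_eq_genusX0 at hg3 hgM
  have ht3 := twelve_mul_genusX0_holds (3 * M)
  have htM := twelve_mul_genusX0_holds M
  unfold twelve_mul_genusX0 at ht3 htM
  rw [hγ, hν2, hν3, hνi] at ht3
  have h4 := finrank_cuspForm_four_eq_of_trace M h1
  have c3 : (12 * (genusX0 (3 * M) : ℂ) + 3 * 0 + 4 * nu₃ M + 6 * (2 * nuInfty M) : ℂ) =
      12 + 4 * gamma0Index M := by exact_mod_cast ht3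
  have cM : (12 * (genusX0 M : ℂ) + 3 * nu₂ M + 4 * nu₃ M + 6 * nuInfty M : ℂ) =
      12 + gamma0Index M := by exact_mod_cast htM
  apply Nat.cast_injective (R := ℂ)
  push_cast
  rw [h4, hg3, hgM]
  linear_combination (1 / 12 : ℂ) * (cM - c3)

omit [NeZero N] in
/-- The same identity at the levels `N/9`, `N/3` of a level `N` with `v₃(N) = 2` (the shape used by the
BSD route items `MiddleResidueRankBound` / `TwistedOldformResidueBasis`), GIVEN the trace formula at
`n = 1`, `k = 4` at every level. [cite: DiamondShurman2005, Thm. 3.5.1, Fig. 3.3] -/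
theorem finrank_cuspForm_four_add_two_eq_of_trace_of_padicValNat
    (hT : ∀ (M : ℕ) [NeZero M], cuspidalHeckeTrace M 4 1 1 = geometricSide M 1 4 1)
    (N : ℕ) [NeZero N] (hv : padicValNat 3 N = 2) :
    Module.finrank ℂ (CuspForm (Gamma0 (N / 9)) 4) + Module.finrank ℂ (CuspForm (Gamma0 (N / 9)) 2) =
      Module.finrank ℂ (CuspForm (Gamma0 (N / 3)) 2) := by
  have key' : ∀ (A B M : ℕ) [NeZero M], ¬ 3 ∣ M → A = M → B = 3 * M →
      Module.finrank ℂ (CuspForm (Gamma0 A) 4) + Module.finrank ℂ (CuspForm (Gamma0 A) 2) =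
        Module.finrank ℂ (CuspForm (Gamma0 B) 2) := by
    intro A B M _ h3M hA hB
    subst hA hB
    exact finrank_cuspForm_four_add_two_eq_of_trace A h3M (hT A)
  have hN : N ≠ 0 := NeZero.ne N
  have h9 : 3 ^ 2 ∣ N := (padicValNat_dvd_iff_le hN).2 (by rw [hv])
  obtain ⟨M, hM⟩ := h9
  have hM0 : M ≠ 0 := by rintro rfl; simp [hM] at hN
  have h3M : ¬ 3 ∣ M := by
    intro h3
    obtain ⟨c, rfl⟩ := h3
    have h27 : 3 ^ 3 ∣ N := ⟨c, by rw [hM]; ring⟩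
    have := (padicValNat_dvd_iff_le hN).1 h27
    omega
  haveI : NeZero M := ⟨hM0⟩
  exact key' (N / 9) (N / 3) M h3M (by omega) (by omega)

section TranscriptionTests

/-! ### Machine-checked transcription tests: the `n = 1`, `k = 4` instance HOLDS at `N = 1`, `N = 2` and `N = 4`

At `N = 1`: `S₄(SL₂(ℤ)) = 0` (Mathlib's `CuspForm.rank_eq_zero_of_weight_lt_twelve`, tree
`cuspForm_gamma0_one_eq_zero`) and `ψ(1)/4 + ν₂(1)/4 − ν_∞(1)/2 = 1/4 + 1/4 − 1/2 = 0` — this tests the SIGN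
of the weight-4 elliptic term (`ν₂(1) = 1 ≠ 0`).  At `N = 4`: `S₄(Γ₀(4)) = 0` (tree
`finrank_cuspForm_four_gamma0_four_eq_zero`) and `6/4 + 0/4 − 3/2 = 0`.  At `N = 2`: `S₄(Γ₀(2)) = 0`
(`finrank_cuspForm_four_gamma0_two_eq_zero` below, from the level restriction `S₄(Γ₀(2)) ↪ S₄(Γ₀(4))`) and
`3/4 + 1/4 − 2/2 = 0`.  (The rows `(ψ, ν₂, ν_∞) = (1,1,1), (3,1,2), (6,0,3)` are linearly dependent, so `N = 2` is a
third kernel instance of the identity but not an independent test of the three coefficients beyond `N = 1, 4`;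
an instance with `dim S₄(Γ₀(N)) ≠ 0` is not available in the tree.) -/

/-- The trace formula at `n = 1`, `k = 4` HOLDS at level `1` (both sides vanish). [cite: DiamondShurman2005, Thm. 3.5.2] -/
theorem traceFormula_four_one_one_level_one : cuspidalHeckeTrace 1 4 1 1 = geometricSide 1 1 4 1 := by
  rw [cuspidalHeckeTrace_one_one, geometricSide_one_four_one]
  have h0 : Module.finrank ℂ (CuspForm (Gamma0 1) 4) = 0 := by
    haveI : Subsingleton (CuspForm (Gamma0 1) 4) := ⟨fun a b ↦ by
      rw [cuspForm_gamma0_one_eq_zero (by norm_num) a, cuspForm_gamma0_one_eq_zero (by norm_num) b]⟩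
    exact Module.finrank_zero_of_subsingleton
  have h1 : gamma0Index 1 = 1 := by simp [gamma0Index]
  have h2 : nu₂ 1 = 1 := nu₂_one_and_nu₃_one.1
  have h3 : nuInfty 1 = 1 := by simp [nuInfty]
  rw [h0, h1, h2, h3]
  norm_num

/-- **`S₄(Γ₀(2)) = 0`**, from the injective level restriction `S₄(Γ₀(2)) ↪ S₄(Γ₀(4))` (`Γ₀(4) ≤ Γ₀(2)`; tree
`restrictLevel_apply_coe_holds`) and `S₄(Γ₀(4)) = 0` (tree `finrank_cuspForm_four_gamma0_four_eq_zero`).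
[cite: DiamondShurman2005, Thm. 3.5.1 (Γ₀(2), k = 4: g = 0, ε₂ = 1, ε₃ = 0, ε_∞ = 2 ⇒ dim S₄ = −3 + 1 + 0 + 2 = 0)] -/
theorem finrank_cuspForm_four_gamma0_two_eq_zero : Module.finrank ℂ (CuspForm (Gamma0 2) 4) = 0 := by
  haveI : FiniteDimensional ℂ (CuspForm (Gamma0 4) 4) :=
    Literature.NumberTheory.EllipticCurves.ModularForms.finiteDimensional_cuspForm_gamma0 4 4
  have hle : Subgroup.map (Matrix.SpecialLinearGroup.mapGL ℝ) (Gamma0 4) ≤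
      Subgroup.map (Matrix.SpecialLinearGroup.mapGL ℝ) (Gamma0 2) :=
    Subgroup.map_mono
      (Literature.NumberTheory.EllipticCurves.ModularForms.gamma0_le_gamma0_of_dvd (by norm_num : 2 ∣ 4))
  have hinj : Function.Injective
      (Literature.NumberTheory.EllipticCurves.ModularForms.restrictLevel (Gamma0 2) (Gamma0 4) 4) := by
    intro f g hfg
    have h := congrArg (fun (h : CuspForm (Gamma0 4) 4) ↦ (⇑h : UpperHalfPlane → ℂ)) hfg
    rw [Literature.NumberTheory.EllipticCurves.ModularForms.restrictLevel_apply_coe_holds _ _ 4 hle f,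
      Literature.NumberTheory.EllipticCurves.ModularForms.restrictLevel_apply_coe_holds _ _ 4 hle g] at h
    exact DFunLike.coe_injective h
  have h4 : Module.finrank ℂ (CuspForm (Gamma0 4) 4) = 0 := by
    have h := Literature.NumberTheory.ModularForms.finrank_cuspForm_four_gamma0_four_eq_zero
    rw [show (((2 * 2 : ℕ) : ℕ) : ℤ) = 4 by norm_num] at h
    exact h
  have h := LinearMap.finrank_le_finrank_of_injective hinj
  omega

/-- The trace formula at `n = 1`, `k = 4` HOLDS at level `2` (both sides vanish: `3/4 + 1/4 − 2/2 = 0`).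
[cite: DiamondShurman2005, Thm. 3.5.1] -/
theorem traceFormula_four_one_one_level_two : cuspidalHeckeTrace 2 4 1 1 = geometricSide 2 1 4 1 := by
  rw [cuspidalHeckeTrace_one_one, geometricSide_one_four_one]
  have h0 := finrank_cuspForm_four_gamma0_two_eq_zero
  have h1 : gamma0Index 2 = 3 := by
    rw [show (2 : ℕ) = 2 ^ 1 from rfl, gamma0Index_prime_pow Nat.prime_two (by norm_num)]
    norm_num
  have h2 : nu₂ 2 = 1 := by
    rw [nu₂_eq_card]
    decide
  have h3 : nuInfty 2 = 2 := by
    unfold nuInfty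
    decide
  rw [h0, h1, h2, h3]
  norm_num

/-- The trace formula at `n = 1`, `k = 4` HOLDS at level `4` (both sides vanish). [cite: DiamondShurman2005, Thm. 3.5.1, Fig. 3.3] -/
theorem traceFormula_four_one_one_level_four : cuspidalHeckeTrace 4 4 1 1 = geometricSide 4 1 4 1 := by
  rw [cuspidalHeckeTrace_one_one, geometricSide_one_four_one]
  have h0 : Module.finrank ℂ (CuspForm (Gamma0 4) 4) = 0 := by
    have h := Literature.NumberTheory.ModularForms.finrank_cuspForm_four_gamma0_four_eq_zero
    rw [show (((2 * 2 : ℕ) : ℕ) : ℤ) = 4 by norm_num] at h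
    exact h
  have h1 : gamma0Index 4 = 6 := by
    rw [show (4 : ℕ) = 2 ^ 2 from rfl, gamma0Index_prime_pow Nat.prime_two (by norm_num)]
    norm_num
  have h2 : nu₂ 4 = 0 := by
    rw [nu₂_eq_card]
    decide
  have h3 : nuInfty 4 = 3 := by
    unfold nuInfty
    decide
  rw [h0, h1, h2, h3]
  norm_num

end TranscriptionTests

end Literature.NumberTheory.Automorphic.HeckeTraceFormulaGL2Level

end
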